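import Literature.AlgebraicGeometry.HodgeTheory.GoursatKolchinRibetCriterion
import Literature.AlgebraicGeometry.HodgeTheory.ZariskiClosureRationalMap
import Literature.AlgebraicGeometry.HodgeTheory.ZariskiClosureBaseChange
import Literature.LinearAlgebra.Matrix.ProjectiveSpecialLinearGroupSimple
import HarnessLib

/-!
# The Goursat–Kolchin–Ribet criterion reduced to its kernels: the block kernels `Kᵢ = {v : ιᵢ(v) ∈ G°}`
# are normalised by `(ρᵢ H)^Zar`, so each contains `SL(Eᵢ)` or is scalar (Katz 1990 Prop. 1.8.2, first
# reduction; Artin, *Geometric Algebra*, Thm 4.9) — on `ℂ`-points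

Family `hodge`, layer `Literature/AlgebraicGeometry/HodgeTheory`. THEOREMS only (no definition, no named
fact), in the vocabulary of `GoursatKolchinRibetCriterion` (`blockDiagHom`, the named fact
`Katz1990_goursatKolchinRibet_specialLinear'`) and of the tree's `K`-points Zariski closure
`glZariskiClosure` / identity component `glIdentityComponent` (`AlgebraicMonodromyMumfordTate`).  Written by
the prover seat `hodge-nonav-prover-Ax` (cell `hodge-nonav`) for crux K1 `VeryGeneralDeckCommutatorsInHg` of
`Summits/HodgeConjecture/HodgeConjecture/Theses/CyclicUnitaryPowers.lean` (`stmt-HodgeConjecture-19544`), whose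
lane D is closed modulo cited facts, one of them the Goursat–Kolchin–Ribet criterion.  This file PROVES the
first reduction of that criterion and isolates what is left (the "Goursat core").

Setting of the fact: `ι` finite, `Eᵢ` finite-dimensional complex spaces, `H ≤ Πᵢ GL(Eᵢ)`,
`Δ = blockDiagHom(H) ≤ GL(⊕ᵢ Eᵢ)`, `G = Δ^Zar`, `G° = glIdentityComponent Δ`, `ρᵢ = Pi.evalMonoidHom _ i`,
`ιᵢ(v) = blockDiagHom (Pi.mulSingle i v)` the `i`-th block embedding `GL(Eᵢ) → GL(⊕ Eⱼ)`.  The `i`-th BLOCK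
KERNEL is `Kᵢ = {v ∈ GL(Eᵢ) : ιᵢ(v) ∈ G°}` — Katz's "kernel of the projection of `G°` onto `Π_{j ≠ i} Gⱼ`",
read on points.

* §1 **Artin's Theorem 4.9 on an abstract space** (`specialLinear_subset_of_forall_conj_mem`): a subgroup of
  `GL(V)` (`dim V ≥ 2`; `dim V ≥ 3` or `K ∌` only `0, ±1` as non-zero squares-roots-of-one, e.g. any infinite
  `K`) normalised by `SL(V)` and containing a non-scalar element contains `SL(V)` — transported from the
  tree's matrix form `LinearAlgebra.Matrix.GLn.range_toGL_le_of_forall_conj_mem` along a basis.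
* §2 `conj_mem_glIdentityComponent` — `(Δ^Zar)°(K)` is normalised by `Δ`.
* §3 the block embedding is polynomial: `toMatrix_blockDiagHom` (block-diagonal matrices in the product
  basis), `toMatrix_blockDiagHom_mulSingle` (the matrix of `ιᵢ(v)` is a polynomial matrix evaluated at the
  matrix of `v`), hence the pull-back `ιᵢ⁻¹(Λ^Zar)` of a closure is Zariski-closed in `GL(Eᵢ)`
  (`blockDiagHom_mulSingle_mem_of_mem_glZariskiClosure_comap`; Borel I.2.1 (b)).
* §4 **`Kᵢ` is normalised by `(ρᵢ H)^Zar`** (`conj_mulSingle_mem_glIdentityComponent`): by `H` through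
  §2, and then by the closure because for fixed `v` the commutator map `s ↦ s v s⁻¹ v⁻¹` carries
  `(ρᵢ H)^Zar` into the closed subgroup `ιᵢ⁻¹((Δ')^Zar)` for every normal finite-index `Δ' ≤ Δ`
  (`GlZariskiClosureGroup.conj_commutator_mem_glZariskiClosure`).
* §5 **The dichotomy** (`blockKernel_dichotomy`): if `SL(Eᵢ) ⊆ (ρᵢ H)^Zar` (weaker than hypothesis (1′) of the
  fact) and `dim Eᵢ ≥ 2`, then EITHER `ιᵢ(SL(Eᵢ)) ⊆ G°` OR every element of `Kᵢ` is scalar; and the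
  **non-degenerate case of the criterion** (`blockDiagHom_mem_glIdentityComponent_of_kernels`): if every `Kᵢ`
  contains a non-scalar element then `Π SL(Eᵢ) ⊆ G°` — the conclusion of
  `Katz1990_goursatKolchinRibet_specialLinear'`.  Packaged: `Katz1990_goursatKolchinRibet_specialLinear'_of_kernels`
  — THE FACT FOLLOWS from its "Goursat core": under (1′), (3), (4) every block kernel contains a non-scalar
  element (in Katz's proof: Goursat's lemma and `Aut 𝔰𝔩ₙ` show that a scalar kernel forces a twist
  `ρᵢ ≅ χ ⊗ ρⱼ` or `ρᵢ^∨ ≅ χ ⊗ ρⱼ`, excluded by (3)–(4); that step needs Lie theory the tree does not have and is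
  NOT proved here).

## References
* [Katz1990ESDE] N. M. Katz, *Exponential Sums and Differential Equations*, Ann. of Math. Stud. 124 (1990),
  §1.8 Prop. 1.8.2 and its proof (p. 31–32: reduction to `G°`, kernels of the projections, Goursat).
* [Artin1988] E. Artin, *Geometric Algebra* (1957/1988), Chap. IV Thm 4.9 (subgroups of `GL_n` normalised by
  `SL_n`).
* [Borel1991] A. Borel, *Linear Algebraic Groups*, 2nd ed., GTM 126 (1991), I.1.2, I.2.1 (b) (closures and
  identity components under morphisms; normality of `G°`).
-/

noncomputable section

open Module Literature.AlgebraicGeometry.Motives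

namespace Literature.AlgebraicGeometry.HodgeTheory

/-! ### §1 Artin's Theorem 4.9 for an abstract finite-dimensional space -/

section Artin

universe u v

variable {K : Type u} [Field K] {V : Type v} [AddCommGroup V] [Module K V] [FiniteDimensional K V]

/-- **Artin, *Geometric Algebra*, Thm 4.9, basis-free**: let `dim V ≥ 3`, or `dim V ≥ 2` and `K` contain an
element `a ≠ 0` with `a² ≠ 1`.  A subgroup `G ≤ GL(V)` normalised by every determinant-one automorphism and
containing a non-scalar element contains every determinant-one automorphism.  (Transport of the tree's
`GLn.range_toGL_le_of_forall_conj_mem` along the isomorphism `GL(V) ≅ GL_n(K)` of a basis.)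
[cite: Artin1988, Chap. IV Thm 4.9] -/
theorem specialLinear_subset_of_forall_conj_mem
    (hV : 3 ≤ finrank K V ∨ (2 ≤ finrank K V ∧ ∃ a : K, a ≠ 0 ∧ a ^ 2 ≠ 1))
    (G : Subgroup (V ≃ₗ[K] V))
    (hG : ∀ s : V ≃ₗ[K] V, LinearEquiv.det s = 1 → ∀ g ∈ G, s * g * s⁻¹ ∈ G)
    (hZ : ∃ g ∈ G, ∀ c : K, (g : V →ₗ[K] V) ≠ c • LinearMap.id)
    (u : V ≃ₗ[K] V) (hu : LinearEquiv.det u = 1) : u ∈ G := by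
  classical
  set n := finrank K V with hn
  let b : Module.Basis (Fin n) K V := Module.finBasis K V
  -- the isomorphism `GL(V) ≅ GL_n(K)` of the basis `b`, and its matrix / determinant
  let Ψ : (V ≃ₗ[K] V) ≃* GL (Fin n) K :=
    (LinearMap.GeneralLinearGroup.generalLinearEquiv K V).symm.trans
      (Units.mapEquiv (LinearMap.toMatrixAlgEquiv b).toMulEquiv)
  have hΨ : ∀ g : V ≃ₗ[K] V, ((Ψ g : GL (Fin n) K) : Matrix (Fin n) (Fin n) K) =
      LinearMap.toMatrix b b (g : V →ₗ[K] V) := fun g => rfl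
  have hdet : ∀ g : V ≃ₗ[K] V,
      Matrix.det ((Ψ g : GL (Fin n) K) : Matrix (Fin n) (Fin n) K) = (LinearEquiv.det g : K) := by
    intro g
    rw [hΨ, LinearMap.det_toMatrix, LinearEquiv.coe_det]
  have h2 : 2 ≤ n := by
    rcases hV with h | h
    · exact le_trans (by norm_num) h
    · exact h.1
  haveI : Nontrivial (Fin n) := Fin.nontrivial_iff_two_le.2 h2
  have hF : 3 ≤ Fintype.card (Fin n) ∨ ∃ a : K, a ≠ 0 ∧ a ^ 2 ≠ 1 := by
    rw [Fintype.card_fin]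
    exact hV.imp id And.right
  let G' : Subgroup (GL (Fin n) K) := G.map Ψ.toMonoidHom
  have hmem : ∀ x : GL (Fin n) K, x ∈ G' ↔ Ψ.symm x ∈ G := fun x => Subgroup.mem_map_equiv
  have hG' : ∀ (S : Matrix.SpecialLinearGroup (Fin n) K) (g : GL (Fin n) K), g ∈ G' →
      Matrix.SpecialLinearGroup.toGL S * g * (Matrix.SpecialLinearGroup.toGL S)⁻¹ ∈ G' := by
    intro S g hg
    rw [hmem] at hg ⊢
    rw [map_mul, map_mul, map_inv]
    refine hG _ ?_ _ hg
    have h1 := hdet (Ψ.symm (Matrix.SpecialLinearGroup.toGL S))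
    rw [MulEquiv.apply_symm_apply, Matrix.SpecialLinearGroup.coe_GL_coe_matrix, S.2] at h1
    exact Units.ext (by rw [Units.val_one]; exact h1.symm)
  have hZ' : ¬ G' ≤ Subgroup.center (GL (Fin n) K) := by
    obtain ⟨g₀, hg₀, hg₀s⟩ := hZ
    intro hle
    have hc : Ψ g₀ ∈ Subgroup.center (GL (Fin n) K) := by
      refine hle ?_
      rw [hmem, MulEquiv.symm_apply_apply]
      exact hg₀
    rw [Matrix.GeneralLinearGroup.mem_center_iff_val_mem_range_scalar] at hc
    obtain ⟨r, hr⟩ := hc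
    refine hg₀s r ?_
    have h1 : LinearMap.toMatrix b b (g₀ : V →ₗ[K] V) = LinearMap.toMatrix b b (r • (LinearMap.id : V →ₗ[K] V)) := by
      rw [← hΨ, ← hr, LinearEquiv.map_smul, LinearMap.toMatrix_id, Matrix.scalar_apply, Matrix.smul_one_eq_diagonal]
    exact (LinearMap.toMatrix b b).injective h1
  have hrange := Literature.LinearAlgebra.Matrix.GLn.range_toGL_le_of_forall_conj_mem hF G' hG' hZ'
  have hΨu : Ψ u ∈ G' := by
    refine hrange ⟨⟨((Ψ u : GL (Fin n) K) : Matrix (Fin n) (Fin n) K), ?_⟩, Units.ext rfl⟩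
    rw [hdet, hu, Units.val_one]
  rw [hmem, MulEquiv.symm_apply_apply] at hΨu
  exact hΨu

end Artin

/-! ### §2 The identity component is normalised by the group -/

section IdentityComponent

universe u v

variable {K : Type u} [Field K] {V : Type v} [AddCommGroup V] [Module K V] [Module.Finite K V]

/-- **`(Δ^Zar)°(K)` is normalised by `Δ`**: for `γ ∈ Δ` and `g ∈ glIdentityComponent Δ`,
`γ g γ⁻¹ ∈ glIdentityComponent Δ` (the closures of the normal finite-index subgroups, which suffice, are
normalised by `Δ`). [cite: Borel1991, I.1.2 and I.2.1] -/
theorem conj_mem_glIdentityComponent {Δ : Subgroup (V ≃ₗ[K] V)} {γ g : V ≃ₗ[K] V} (hγ : γ ∈ Δ)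
    (hg : g ∈ glIdentityComponent Δ) : γ * g * γ⁻¹ ∈ glIdentityComponent Δ :=
  mem_glIdentityComponent_of_forall_normal fun _ hle hfi hN =>
    conj_mem_glZariskiClosure_of_normal hle hN hγ (glIdentityComponent_subset_of_finiteIndex hle hfi hg)

end IdentityComponent

/-! ### §3 The block embedding `ιᵢ : GL(Eᵢ) → GL(⊕ⱼ Eⱼ)` is polynomial -/

section Blocks

universe u v

variable {ι : Type u} [Fintype ι] [DecidableEq ι] {E : ι → Type v} [∀ i, AddCommGroup (E i)]
  [∀ i, Module ℂ (E i)]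

omit [Fintype ι] in
/-- Conjugating the `i`-th block embedding by a block-diagonal family conjugates the block:
`h · ιᵢ(v) · h⁻¹ = ιᵢ(hᵢ v hᵢ⁻¹)` in `Πⱼ GL(Eⱼ)`. [folklore] -/
private theorem mul_mulSingle_mul_inv (h : Π j, (E j ≃ₗ[ℂ] E j)) (i : ι) (v : E i ≃ₗ[ℂ] E i) :
    h * Pi.mulSingle i v * h⁻¹ = Pi.mulSingle i (h i * v * (h i)⁻¹) := by
  funext j
  by_cases hj : j = i
  · subst hj
    rw [Pi.mul_apply, Pi.mul_apply, Pi.inv_apply, Pi.mulSingle_eq_same, Pi.mulSingle_eq_same]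
  · rw [Pi.mul_apply, Pi.mul_apply, Pi.inv_apply, Pi.mulSingle_eq_of_ne hj, Pi.mulSingle_eq_of_ne hj, mul_one,
      mul_inv_cancel]

variable {κ : ι → Type*} [∀ i, Fintype (κ i)] [∀ i, DecidableEq (κ i)]

/-- **Block-diagonal matrices**: in the product basis `Pi.basis b` the matrix of `blockDiagHom E s = ⊕ⱼ sⱼ` is
the block-diagonal matrix of the matrices of the `sⱼ` (Katz: "the subgroup `Π Gᵢ` of `Π GL(Vᵢ)`").
[cite: Katz1990ESDE, §1.8 Prop. 1.8.2] -/
theorem toMatrix_blockDiagHom (b : ∀ j, Module.Basis (κ j) ℂ (E j)) (s : Π j, (E j ≃ₗ[ℂ] E j)) :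
    LinearMap.toMatrix (Pi.basis b) (Pi.basis b)
        ((blockDiagHom E s : (Π j, E j) ≃ₗ[ℂ] (Π j, E j)) : Module.End ℂ (Π j, E j)) =
      Matrix.blockDiagonal' fun j => LinearMap.toMatrix (b j) (b j) ((s j : E j ≃ₗ[ℂ] E j) : Module.End ℂ (E j)) := by
  ext ⟨j, k⟩ ⟨j', k'⟩
  rw [LinearMap.toMatrix_apply, Pi.basis_apply, Pi.basis_repr, LinearEquiv.coe_coe, blockDiagHom_apply]
  by_cases h : j = j'
  · subst h
    rw [Matrix.blockDiagonal'_apply_eq, Pi.single_eq_same, LinearMap.toMatrix_apply, LinearEquiv.coe_coe]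
  · rw [Matrix.blockDiagonal'_apply_ne _ _ _ h, Pi.single_eq_of_ne h, map_zero, map_zero, Finsupp.zero_apply]

/-- **The `i`-th block embedding is a polynomial map**: the matrix of `ιᵢ(v) = blockDiagHom (Pi.mulSingle i v)`
in the product basis is the block-diagonal polynomial matrix (generic matrix in block `i`, identity
elsewhere) evaluated at the matrix of `v`. [cite: Borel1991, I.2.1] -/
theorem toMatrix_blockDiagHom_mulSingle (b : ∀ j, Module.Basis (κ j) ℂ (E j)) (i : ι) (v : E i ≃ₗ[ℂ] E i) :
    LinearMap.toMatrix (Pi.basis b) (Pi.basis b)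
        ((blockDiagHom E (Pi.mulSingle i v) : (Π j, E j) ≃ₗ[ℂ] (Π j, E j)) : Module.End ℂ (Π j, E j)) =
      (MvPolynomial.eval fun kl : κ i × κ i =>
          LinearMap.toMatrix (b i) (b i) ((v : E i ≃ₗ[ℂ] E i) : Module.End ℂ (E i)) kl.1 kl.2).mapMatrix
        (Matrix.blockDiagonal'
          (Function.update (fun j => (1 : Matrix (κ j) (κ j) (MvPolynomial (κ i × κ i) ℂ))) i
            (Matrix.of fun k l : κ i => MvPolynomial.X (k, l)))) := by
  rw [toMatrix_blockDiagHom, RingHom.mapMatrix_apply, Matrix.blockDiagonal'_map _ _ (map_zero _)]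
  congr 1
  funext j
  by_cases hj : j = i
  · subst hj
    rw [Function.update_self, Pi.mulSingle_eq_same]
    ext k l
    rw [Matrix.map_apply, Matrix.of_apply, MvPolynomial.eval_X]
  · rw [Function.update_of_ne hj, Pi.mulSingle_eq_of_ne hj, LinearEquiv.coe_toLinearMap_one, LinearMap.toMatrix_id,
      Matrix.map_one _ (map_zero _) (map_one _)]

variable [∀ i, FiniteDimensional ℂ (E i)]

/-- **The pull-back `ιᵢ⁻¹(Λ^Zar)` of a Zariski closure along the block embedding is Zariski-closed in
`GL(Eᵢ)`** (Borel I.2.1 (b): preimages of closed sets under morphisms are closed; on `ℂ`-points): if `g`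
lies in the closure of the subgroup `ιᵢ⁻¹(Λ^Zar(ℂ))` then `ιᵢ(g) ∈ Λ^Zar(ℂ)`. [cite: Borel1991, I.2.1] -/
theorem blockDiagHom_mulSingle_mem_of_mem_glZariskiClosure_comap
    (Λ : Subgroup ((Π j, E j) ≃ₗ[ℂ] (Π j, E j))) (i : ι) {g : E i ≃ₗ[ℂ] E i}
    (hg : g ∈ glZariskiClosure ((glZariskiClosureSubgroup Λ).comap
      ((blockDiagHom E).comp (MonoidHom.mulSingle (fun j => E j ≃ₗ[ℂ] E j) i)))) :
    blockDiagHom E (Pi.mulSingle i g) ∈ glZariskiClosure Λ := by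
  classical
  let b : ∀ j, Module.Basis (Fin (finrank ℂ (E j))) ℂ (E j) := fun j => Module.finBasis ℂ (E j)
  have h := mem_glZariskiClosure_of_polynomialMap₂ (b i) (Pi.basis b)
    (Γ := (glZariskiClosureSubgroup Λ).comap ((blockDiagHom E).comp (MonoidHom.mulSingle (fun j => E j ≃ₗ[ℂ] E j) i)))
    (Γ' := glZariskiClosureSubgroup Λ)
    (Matrix.blockDiagonal'
      (Function.update (fun j => (1 : Matrix (Fin (finrank ℂ (E j))) (Fin (finrank ℂ (E j)))
        (MvPolynomial (Fin (finrank ℂ (E i)) × Fin (finrank ℂ (E i))) ℂ))) i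
        (Matrix.of fun k l : Fin (finrank ℂ (E i)) => MvPolynomial.X (k, l))))
    (fun v : E i ≃ₗ[ℂ] E i => blockDiagHom E (Pi.mulSingle i v))
    (fun v => toMatrix_blockDiagHom_mulSingle b i v) (fun γ hγ => hγ) hg
  rwa [glZariskiClosure_glZariskiClosureSubgroup] at h

/-! ### §4 The block kernels are normalised by the closures of the projections -/

/-- **The block kernel `Kᵢ = {v : ιᵢ(v) ∈ G°}` is normalised by `(ρᵢ H)^Zar(ℂ)`** (`G° = glIdentityComponent Δ`,
`Δ = blockDiagHom(H)`): for `ιᵢ(v) ∈ G°` and `s ∈ glZariskiClosure (ρᵢ H)`, `ιᵢ(s v s⁻¹) ∈ G°`.  Proof: it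
suffices to land in `(Δ')^Zar` for every normal finite-index `Δ' ≤ Δ`; `Kᵢ' = ιᵢ⁻¹((Δ')^Zar)` is a closed
subgroup of `GL(Eᵢ)` (§3) normalised by `ρᵢ(H)` (§2-type conjugation, `h ιᵢ(v) h⁻¹ = ιᵢ(hᵢ v hᵢ⁻¹)`), so
the commutator map `s ↦ s v s⁻¹ v⁻¹` sends `ρᵢ(H)`, hence its closure, into `Kᵢ'`
(`conj_commutator_mem_glZariskiClosure`). [cite: Katz1990ESDE, §1.8 Prop. 1.8.2 (proof)] [cite: Borel1991, I.2.1] -/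
theorem conj_mulSingle_mem_glIdentityComponent (H : Subgroup (Π j, (E j ≃ₗ[ℂ] E j))) (i : ι)
    {v : E i ≃ₗ[ℂ] E i} (hv : blockDiagHom E (Pi.mulSingle i v) ∈ glIdentityComponent (H.map (blockDiagHom E)))
    {s : E i ≃ₗ[ℂ] E i} (hs : s ∈ glZariskiClosure (H.map (Pi.evalMonoidHom (fun j => E j ≃ₗ[ℂ] E j) i))) :
    blockDiagHom E (Pi.mulSingle i (s * v * s⁻¹)) ∈ glIdentityComponent (H.map (blockDiagHom E)) := by
  set ιi : (E i ≃ₗ[ℂ] E i) →* ((Π j, E j) ≃ₗ[ℂ] (Π j, E j)) :=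
    (blockDiagHom E).comp (MonoidHom.mulSingle (fun j => E j ≃ₗ[ℂ] E j) i) with hιi_def
  have hιi : ∀ w : E i ≃ₗ[ℂ] E i, ιi w = blockDiagHom E (Pi.mulSingle i w) := fun w => rfl
  refine mem_glIdentityComponent_of_forall_normal fun Δ' hle hfi hN => ?_
  -- the closed subgroup `Kᵢ' = ιᵢ⁻¹((Δ')^Zar)` of `GL(Eᵢ)`
  let K' : Subgroup (E i ≃ₗ[ℂ] E i) := (glZariskiClosureSubgroup Δ').comap ιi
  have hK'mem : ∀ w : E i ≃ₗ[ℂ] E i, w ∈ K' ↔ blockDiagHom E (Pi.mulSingle i w) ∈ glZariskiClosure Δ' := fun w =>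
    Iff.rfl
  have hvK' : v ∈ K' := (hK'mem v).2 (glIdentityComponent_subset_of_finiteIndex hle hfi hv)
  -- the commutator `s v s⁻¹ v⁻¹` lies in the closure of `Kᵢ'`, which is `Kᵢ'`
  have hcomm : s * v * s⁻¹ * v⁻¹ ∈ glZariskiClosure K' := by
    refine conj_commutator_mem_glZariskiClosure
      (Δ₁ := H.map (Pi.evalMonoidHom (fun j => E j ≃ₗ[ℂ] E j) i)) (fun a ha => subset_glZariskiClosure K' ?_) hs
    obtain ⟨h, hh, rfl⟩ := Subgroup.mem_map.1 ha
    rw [Pi.evalMonoidHom_apply]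
    refine K'.mul_mem ((hK'mem _).2 ?_) (K'.inv_mem hvK')
    rw [← mul_mulSingle_mul_inv, map_mul, map_mul, map_inv]
    exact conj_mem_glZariskiClosure_of_normal hle hN (Subgroup.mem_map_of_mem (blockDiagHom E) hh) ((hK'mem v).1 hvK')
  have hmem : s * v * s⁻¹ * v⁻¹ ∈ K' :=
    (hK'mem _).2 (blockDiagHom_mulSingle_mem_of_mem_glZariskiClosure_comap Δ' i hcomm)
  have h2 : s * v * s⁻¹ = (s * v * s⁻¹ * v⁻¹) * v := by group
  rw [h2]
  exact (hK'mem _).1 (K'.mul_mem hmem hvK')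

/-! ### §5 The dichotomy and the non-degenerate case of the criterion -/

/-- **Block-kernel dichotomy** (Katz's proof of Prop. 1.8.2, first reduction, with Artin's Thm 4.9): if
`dim Eᵢ ≥ 2` and `SL(Eᵢ)(ℂ) ⊆ (ρᵢ H)^Zar(ℂ)` (e.g. hypothesis (1′) of the fact), then EITHER the whole block
`ιᵢ(SL(Eᵢ))` lies in `G° = glIdentityComponent (H.map blockDiagHom)`, OR every `v ∈ GL(Eᵢ)` with `ιᵢ(v) ∈ G°`
is a scalar. [cite: Katz1990ESDE, §1.8 Prop. 1.8.2 (proof)] [cite: Artin1988, Chap. IV Thm 4.9] -/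
theorem blockKernel_dichotomy (H : Subgroup (Π j, (E j ≃ₗ[ℂ] E j))) (i : ι) (hE : 2 ≤ finrank ℂ (E i))
    (h1 : ∀ u : E i ≃ₗ[ℂ] E i, LinearEquiv.det u = 1 →
      u ∈ glZariskiClosure (H.map (Pi.evalMonoidHom (fun j => E j ≃ₗ[ℂ] E j) i))) :
    (∀ u : E i ≃ₗ[ℂ] E i, LinearEquiv.det u = 1 →
        blockDiagHom E (Pi.mulSingle i u) ∈ glIdentityComponent (H.map (blockDiagHom E))) ∨
      (∀ v : E i ≃ₗ[ℂ] E i, blockDiagHom E (Pi.mulSingle i v) ∈ glIdentityComponent (H.map (blockDiagHom E)) →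
        ∃ c : ℂ, (v : E i →ₗ[ℂ] E i) = c • LinearMap.id) := by
  by_cases hsc : ∀ v : E i ≃ₗ[ℂ] E i,
      blockDiagHom E (Pi.mulSingle i v) ∈ glIdentityComponent (H.map (blockDiagHom E)) →
        ∃ c : ℂ, (v : E i →ₗ[ℂ] E i) = c • LinearMap.id
  · exact Or.inr hsc
  left
  obtain ⟨v₀, hv₀'⟩ := not_forall.mp hsc
  obtain ⟨hv₀, hv₀s'⟩ := Classical.not_imp.mp hv₀'
  have hv₀s : ∀ c : ℂ, (v₀ : E i →ₗ[ℂ] E i) ≠ c • LinearMap.id := fun c hc => hv₀s' ⟨c, hc⟩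
  set ιi : (E i ≃ₗ[ℂ] E i) →* ((Π j, E j) ≃ₗ[ℂ] (Π j, E j)) :=
    (blockDiagHom E).comp (MonoidHom.mulSingle (fun j => E j ≃ₗ[ℂ] E j) i) with hιi_def
  have hιi : ∀ w : E i ≃ₗ[ℂ] E i, ιi w = blockDiagHom E (Pi.mulSingle i w) := fun w => rfl
  -- the block kernel `Kᵢ` as a subgroup of `GL(Eᵢ)`
  let KG : Subgroup (E i ≃ₗ[ℂ] E i) :=
    { carrier := {w | blockDiagHom E (Pi.mulSingle i w) ∈ glIdentityComponent (H.map (blockDiagHom E))}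
      one_mem' := by
        change blockDiagHom E (Pi.mulSingle i 1) ∈ glIdentityComponent (H.map (blockDiagHom E))
        rw [← hιi, map_one]
        exact one_mem_glIdentityComponent _
      mul_mem' := fun {x y} hx hy => by
        change blockDiagHom E (Pi.mulSingle i (x * y)) ∈ glIdentityComponent (H.map (blockDiagHom E))
        rw [← hιi, map_mul]
        exact mul_mem_glIdentityComponent hx hy
      inv_mem' := fun {x} hx => by
        change blockDiagHom E (Pi.mulSingle i x⁻¹) ∈ glIdentityComponent (H.map (blockDiagHom E))
        rw [← hιi, map_inv]
        exact inv_mem_glIdentityComponent hx }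
  have hKG : ∀ w, w ∈ KG ↔ blockDiagHom E (Pi.mulSingle i w) ∈ glIdentityComponent (H.map (blockDiagHom E)) :=
    fun w => Iff.rfl
  intro u hu
  refine (hKG u).1 (specialLinear_subset_of_forall_conj_mem (Or.inr ⟨hE, 2, two_ne_zero, by norm_num⟩) KG
    (fun s hs w hw => (hKG _).2 (conj_mulSingle_mem_glIdentityComponent H i ((hKG w).1 hw) (h1 s hs)))
    ⟨v₀, (hKG v₀).2 hv₀, hv₀s⟩ u hu)

/-- **The non-degenerate case of the Goursat–Kolchin–Ribet criterion**: if `dim Eᵢ ≥ 2`,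
`SL(Eᵢ)(ℂ) ⊆ (ρᵢ H)^Zar(ℂ)` for every `i`, and every block kernel `Kᵢ` contains a NON-SCALAR element (some
`v`, not a multiple of the identity, with `ιᵢ(v) ∈ G°`), then `Π SL(Eᵢ)(ℂ) ⊆ G°`: every block-diagonal
family of determinant-one automorphisms lies in `glIdentityComponent (H.map blockDiagHom)` — the conclusion of
`Katz1990_goursatKolchinRibet_specialLinear'`. [cite: Katz1990ESDE, §1.8 Prop. 1.8.2 (proof)] [cite: Artin1988, Chap. IV Thm 4.9] -/
theorem blockDiagHom_mem_glIdentityComponent_of_kernels (H : Subgroup (Π j, (E j ≃ₗ[ℂ] E j)))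
    (hE : ∀ i, 2 ≤ finrank ℂ (E i))
    (h1 : ∀ i, ∀ u : E i ≃ₗ[ℂ] E i, LinearEquiv.det u = 1 →
      u ∈ glZariskiClosure (H.map (Pi.evalMonoidHom (fun j => E j ≃ₗ[ℂ] E j) i)))
    (hker : ∀ i, ∃ v : E i ≃ₗ[ℂ] E i,
      blockDiagHom E (Pi.mulSingle i v) ∈ glIdentityComponent (H.map (blockDiagHom E)) ∧
        ∀ c : ℂ, (v : E i →ₗ[ℂ] E i) ≠ c • LinearMap.id)
    (u : Π j, (E j ≃ₗ[ℂ] E j)) (hu : ∀ i, LinearEquiv.det (u i) = 1) :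
    blockDiagHom E u ∈ glIdentityComponent (H.map (blockDiagHom E)) := by
  have hfac : ∀ i, blockDiagHom E (Pi.mulSingle i (u i)) ∈ glIdentityComponent (H.map (blockDiagHom E)) := by
    intro i
    rcases blockKernel_dichotomy H i (hE i) (h1 i) with h | h
    · exact h (u i) (hu i)
    · obtain ⟨v, hv, hvs⟩ := hker i
      obtain ⟨c, hc⟩ := h v hv
      exact absurd hc (hvs c)
  rw [← Finset.noncommProd_mulSingle u, Finset.map_noncommProd]
  refine Finset.noncommProd_induction _ _ _
    (fun x => x ∈ glIdentityComponent (H.map (blockDiagHom E))) (fun a b ha hb => mul_mem_glIdentityComponent ha hb)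
    (one_mem_glIdentityComponent _) fun i _ => hfac i

end Blocks

/-! ### §6 The named fact follows from its Goursat core -/

/-- **`Katz1990_goursatKolchinRibet_specialLinear'` reduced to its Goursat core.**  The fact holds as soon
as, in its own setting (`|ι| ≥ 2`, `dim Eᵢ ≥ 2`, `H ≤ Π GL(Eᵢ)`, hypotheses (1′), (3), (4)), every block
kernel `Kᵢ = {v : blockDiagHom (Pi.mulSingle i v) ∈ glIdentityComponent (H.map blockDiagHom)}` contains a
non-scalar element — the step of Katz's proof carried by Goursat's lemma and the automorphisms of `𝔰𝔩ₙ`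
(a scalar `Kᵢ` would make `G°` a graph over the other factors, i.e. a twist `ρᵢ ≅ χ ⊗ ρⱼ` or
`ρᵢ^∨ ≅ χ ⊗ ρⱼ`, against (3)–(4)).  This theorem is the remainder of the proof.
[cite: Katz1990ESDE, §1.8 Prop. 1.8.2 (proof)] -/
theorem Katz1990_goursatKolchinRibet_specialLinear'_of_kernels
    (hcore : ∀ (ι : Type) [Fintype ι] [DecidableEq ι], 2 ≤ Fintype.card ι →
      ∀ (E : ι → Type) [∀ i, AddCommGroup (E i)] [∀ i, Module ℂ (E i)] [∀ i, FiniteDimensional ℂ (E i)],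
        (∀ i, 2 ≤ finrank ℂ (E i)) →
      ∀ (H : Subgroup (Π i, (E i ≃ₗ[ℂ] E i))),
        (∀ i, ∀ u : E i ≃ₗ[ℂ] E i, LinearEquiv.det u = 1 →
          u ∈ glIdentityComponent (H.map (Pi.evalMonoidHom (fun i => E i ≃ₗ[ℂ] E i) i))) →
        (∀ i j, i ≠ j → ¬ ∃ (A : E i ≃ₗ[ℂ] E j) (χ : (Π i, (E i ≃ₗ[ℂ] E i)) → ℂ), ∀ s ∈ H,
          (A : E i →ₗ[ℂ] E j) ∘ₗ (s i : E i →ₗ[ℂ] E i) =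
            χ s • ((s j : E j →ₗ[ℂ] E j) ∘ₗ (A : E i →ₗ[ℂ] E j))) →
        (∀ i j, i ≠ j → ¬ ∃ (A : Module.Dual ℂ (E i) ≃ₗ[ℂ] E j) (χ : (Π i, (E i ≃ₗ[ℂ] E i)) → ℂ), ∀ s ∈ H,
          (A : Module.Dual ℂ (E i) →ₗ[ℂ] E j) ∘ₗ ((s i).symm : E i →ₗ[ℂ] E i).dualMap =
            χ s • ((s j : E j →ₗ[ℂ] E j) ∘ₗ (A : Module.Dual ℂ (E i) →ₗ[ℂ] E j))) →
        ∀ i, ∃ v : E i ≃ₗ[ℂ] E i,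
          blockDiagHom E (Pi.mulSingle i v) ∈ glIdentityComponent (H.map (blockDiagHom E)) ∧
            ∀ c : ℂ, (v : E i →ₗ[ℂ] E i) ≠ c • LinearMap.id) :
    Katz1990_goursatKolchinRibet_specialLinear' := by
  intro ι _ hι E _ _ _ hE H h1 h3 h4 u hu
  classical
  exact blockDiagHom_mem_glIdentityComponent_of_kernels H hE
    (fun i v hv => glIdentityComponent_subset_glZariskiClosure _ (h1 i v hv)) (hcore ι hι E hE H h1 h3 h4) u hu

end Literature.AlgebraicGeometry.HodgeTheory

end
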